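import Summits.NavierStokesRegularity.FluidComputer.RiccatiSummationGen
import HarnessLib

/-!
# Fluid computer — support: the transfer at ANY weight `2^{κj}`, `κ ≥ 1`, is slaved to the Lipschitz row
# `R = ∑_l 2^l ‖Δ̇_l u‖_∞` (towards Robinson–Sadowski–Silva's `Ḣ^s` rate `2s/5` for `s > 5/2`)

HONEST FRAMING (cell `pub-fluidc`, verbatim): *low prior, high value-of-information experiment on Tao's
machine paradigm; NOT a claim that NS blows up.* Support file (bookkeeping on sequences of levels plus one field-level
corollary; no blow-up content).

`RiccatiSummationGen.riccati_summation_gen` bounds the `2^{κj}`-weighted low-mode shapes of the block transfer by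
`y_κ · D₅^{1/2}` (`D₅ = ∑_j 32^j a_j²`), which needs `κ < 5`. Keeping instead the coarse strain as the FULL Lipschitz row
`R = ∑_{l∈ℤ} 2^l s_l` (`s_l = ‖Δ̇_l u‖_∞`; `R ≳ ‖∇u‖_∞`, the `Ḃ^1_{∞,1}` size) removes every restriction on the weight:
for all `a, s ≥ 0` on `ℤ` and every `κ ≥ 1`,

  `∑_j 2^{κj} (a_j ∑_{|m|≤2} a_{j+m} T_{j+m} + s_j Q_j) ≤ C_κ · (∑_j 2^{κj} a_j²) · R`,

`T = paraT (2^· s)` (so `T_l ≤ R` trivially: `paraT_le_row`), `Q = paraQ2 a (2^· a)` (the fine pairs: the weight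
`2^{κj}` on the sup index `j ≤ l + 4` is moved to the fine level `l` at the cost `2^{4(κ−1)}`, `highHigh_lipschitz_le`),
`C_κ = 5·2^κ + 5·2^{5κ}` (`lipschitz_summation`). With the tree's pointwise transfer ceiling
(`RiccatiSlice.exists_enorm_transfer_le_local`) this gives the field-level bound `transfer_row_le_lipschitz`:
`∑_j 2^{κj} ‖∫⟪Δ̇_j w, Δ̇_j((w·∇)w)⟫‖ ≤ A_κ · (∑_j 2^{κj} ‖Δ̇_j w‖₂²) · ∑_l 2^l ‖Δ̇_l w‖_∞` for every smooth divergence-free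
`L²` field — the dyadic form of the classical commutator estimate `|⟨Λ^s((u·∇)u), Λ^s u⟩| ≲ ‖∇u‖_{Ḃ^0_{∞,1}} ‖u‖²_{Ḣ^s}`
(Robinson–Sadowski–Silva 2012 (3.6) with their `‖u‖_{F¹}`; Bahouri–Chemin–Danchin Lemma 2.100). 0 sorry; no definitions;
no named facts.

## References

* J. C. Robinson, W. Sadowski, R. P. Silva, J. Math. Phys. 53 (2012) 115618, §III (3.6), §VI. [RobinsonSadowskiSilva2012]
* H. Bahouri, J.-Y. Chemin, R. Danchin, Grundlehren 343 (2011), Lemma 2.100 / §2.6. [BahouriCheminDanchin2011]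
-/

noncomputable section

open MeasureTheory Set Function Filter Topology Metric
open scoped ENNReal NNReal RealInnerProductSpace
open Literature.Analysis.FluidPDE Literature.Analysis.FunctionSpaces
open Summit.NavierStokesRegularity.FluidComputer.RiccatiSummationTools
open Summit.NavierStokesRegularity.FluidComputer.RiccatiSummationGen (two_rpow_add tsum_half_sq)

namespace Summit.NavierStokesRegularity.FluidComputer.LipschitzSummation

variable (a s : ℤ → ℝ≥0∞)

/-! ## The coarse strain is a piece of the Lipschitz row -/

/-- **`T_l ≤ R`**: the coarse strain below a level, `∑_{n≥0} 2^{l−3−n} s_{l−3−n}`, is at most the whole Lipschitz row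
`∑_{l'∈ℤ} 2^{l'} s_{l'}` (a sub-family of the terms). [folklore] -/
theorem paraT_le_row (l : ℤ) :
    paraT (fun l' => (2 : ℝ≥0∞) ^ l' * s l') l ≤ ∑' l' : ℤ, (2 : ℝ≥0∞) ^ l' * s l' :=
  ENNReal.tsum_comp_le_tsum_of_injective (f := fun n : ℕ => l - 3 - (n : ℤ))
    (fun x y hxy => by simpa using hxy) (fun l' => (2 : ℝ≥0∞) ^ l' * s l')

/-- **A shifted piece of the Lipschitz row**: `∑_{n≥0} 2^{q−n} s_{q−n} ≤ ∑_{l'} 2^{l'} s_{l'}`. [folklore] -/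
theorem tsum_shift_le_row (q : ℤ) :
    ∑' n : ℕ, (2 : ℝ≥0∞) ^ (q - (n : ℤ)) * s (q - n) ≤ ∑' l' : ℤ, (2 : ℝ≥0∞) ^ l' * s l' :=
  ENNReal.tsum_comp_le_tsum_of_injective (f := fun n : ℕ => q - (n : ℤ))
    (fun x y hxy => by simpa using hxy) (fun l' => (2 : ℝ≥0∞) ^ l' * s l')

/-- The `κ`-row pairing at offset `m`: `∑_j 2^{κj} a_j a_{j+m} ≤ 2^{−κm/2} ∑_j 2^{κj} a_j²` (shifted Cauchy–Schwarz
between `2^{κj/2} a_j` and `2^{κ(j+m)/2} a_{j+m}`). [folklore] -/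
theorem tsum_weight_mul_shift_le (κ : ℝ) (m : ℤ) :
    ∑' j : ℤ, (2 : ℝ≥0∞) ^ (κ * (j : ℝ)) * (a j * a (j + m)) ≤
      (2 : ℝ≥0∞) ^ (-(κ / 2) * (m : ℝ)) * ∑' j : ℤ, (2 : ℝ≥0∞) ^ (κ * (j : ℝ)) * a j ^ 2 := by
  set x : ℤ → ℝ≥0∞ := fun k => (2 : ℝ≥0∞) ^ (κ / 2 * (k : ℝ)) * a k with hx
  set Y : ℝ≥0∞ := ∑' j : ℤ, (2 : ℝ≥0∞) ^ (κ * (j : ℝ)) * a j ^ 2 with hY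
  have hx2 : ∑' k : ℤ, x k ^ 2 = Y := by rw [hx, tsum_half_sq]
  have hterm : ∀ j : ℤ, (2 : ℝ≥0∞) ^ (κ * (j : ℝ)) * (a j * a (j + m)) =
      (2 : ℝ≥0∞) ^ (-(κ / 2) * (m : ℝ)) * (x j * x (j + m)) := by
    intro j
    have epow : (2 : ℝ≥0∞) ^ (κ * (j : ℝ)) =
        (2 : ℝ≥0∞) ^ (-(κ / 2) * (m : ℝ)) * ((2 : ℝ≥0∞) ^ (κ / 2 * (j : ℝ)) * (2 : ℝ≥0∞) ^ (κ / 2 * ((j + m : ℤ) : ℝ))) := by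
      rw [← two_rpow_add, ← two_rpow_add]
      congr 1; push_cast; ring
    rw [epow, hx]; ring
  have hYY : Y ^ (1 / 2 : ℝ) * Y ^ (1 / 2 : ℝ) = Y := by
    rw [← sq, ← ENNReal.rpow_natCast, ← ENNReal.rpow_mul]; norm_num
  calc ∑' j : ℤ, (2 : ℝ≥0∞) ^ (κ * (j : ℝ)) * (a j * a (j + m))
      = ∑' j : ℤ, (2 : ℝ≥0∞) ^ (-(κ / 2) * (m : ℝ)) * (x j * x (j + m)) := tsum_congr hterm
    _ = (2 : ℝ≥0∞) ^ (-(κ / 2) * (m : ℝ)) * ∑' j : ℤ, x j * x (j + m) := ENNReal.tsum_mul_left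
    _ ≤ (2 : ℝ≥0∞) ^ (-(κ / 2) * (m : ℝ)) * (Y ^ (1 / 2 : ℝ) * Y ^ (1 / 2 : ℝ)) := by
        rw [← hx2]
        exact mul_le_mul' le_rfl (tsum_mul_shift_le x x m)
    _ = _ := by rw [hYY]

/-! ## The low–high and the high–high sums against the Lipschitz row -/

/-- **The low–high (coarse-strain) sum at weight `2^{κj}` against the Lipschitz row** (`κ ≥ 0`, `m ≥ −2`):
`∑_j 2^{κj} a_j a_{j+m} T_{j+m} ≤ 2^κ · (∑_j 2^{κj} a_j²) · ∑_l 2^l s_l` (`T_{j+m} ≤ R`, then `tsum_weight_mul_shift_le`).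
[cite: RobinsonSadowskiSilva2012, §III (3.6)] -/
theorem lowHigh_lipschitz_le {κ : ℝ} (hκ0 : 0 ≤ κ) (m : ℤ) (hm : -2 ≤ m) :
    ∑' j : ℤ, (2 : ℝ≥0∞) ^ (κ * (j : ℝ)) *
        (a j * (a (j + m) * paraT (fun l' => (2 : ℝ≥0∞) ^ l' * s l') (j + m))) ≤
      (2 : ℝ≥0∞) ^ κ * (∑' j : ℤ, (2 : ℝ≥0∞) ^ (κ * (j : ℝ)) * a j ^ 2) * (∑' l : ℤ, (2 : ℝ≥0∞) ^ l * s l) := by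
  set R : ℝ≥0∞ := ∑' l : ℤ, (2 : ℝ≥0∞) ^ l * s l with hR
  set Y : ℝ≥0∞ := ∑' j : ℤ, (2 : ℝ≥0∞) ^ (κ * (j : ℝ)) * a j ^ 2 with hY
  have hpow : (2 : ℝ≥0∞) ^ (-(κ / 2) * (m : ℝ)) ≤ (2 : ℝ≥0∞) ^ κ := by
    have hm' : (-2 : ℝ) ≤ m := by exact_mod_cast hm
    refine ENNReal.rpow_le_rpow_of_exponent_le (by norm_num) ?_
    nlinarith
  calc ∑' j : ℤ, (2 : ℝ≥0∞) ^ (κ * (j : ℝ)) * (a j * (a (j + m) * paraT (fun l' => (2 : ℝ≥0∞) ^ l' * s l') (j + m)))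
      ≤ ∑' j : ℤ, (2 : ℝ≥0∞) ^ (κ * (j : ℝ)) * (a j * (a (j + m) * R)) := by
        refine ENNReal.tsum_le_tsum fun j => ?_
        gcongr
        exact paraT_le_row s (j + m)
    _ = (∑' j : ℤ, (2 : ℝ≥0∞) ^ (κ * (j : ℝ)) * (a j * a (j + m))) * R := by
        rw [← ENNReal.tsum_mul_right]
        exact tsum_congr fun j => by ring
    _ ≤ ((2 : ℝ≥0∞) ^ (-(κ / 2) * (m : ℝ)) * Y) * R := mul_le_mul' (tsum_weight_mul_shift_le a κ m) le_rfl
    _ ≤ (2 : ℝ≥0∞) ^ κ * Y * R := by gcongr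

/-- **The high–high (fine-pairs) sum at weight `2^{κj}` against the Lipschitz row** (`κ ≥ 1`):
`∑_j 2^{κj} s_j Q_j ≤ 5 · 2^{5κ} · (∑_j 2^{κj} a_j²) · ∑_l 2^l s_l`, `Q_j = paraQ2 a (2^· a) j = ∑_{l≥j−4, |m|≤2} a_l 2^{l+m} a_{l+m}`:
reindex to the fine level `l`, move the weight `2^{κj} = 2^{(κ−1)j} 2^j` with `2^{(κ−1)j} ≤ 2^{(κ−1)(l+4)}` (`j ≤ l+4`, `κ ≥ 1`),
sum `∑_{j≤l+4} 2^j s_j ≤ R`, and pair `2^{κl} a_l a_{l+m}` by `tsum_weight_mul_shift_le`. [cite: RobinsonSadowskiSilva2012, §III (3.6)]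
[cite: BahouriCheminDanchin2011, Lemma 2.100] -/
theorem highHigh_lipschitz_le {κ : ℝ} (hκ1 : 1 ≤ κ) :
    ∑' j : ℤ, (2 : ℝ≥0∞) ^ (κ * (j : ℝ)) * (s j * paraQ2 a (fun l => (2 : ℝ≥0∞) ^ l * a l) j) ≤
      5 * (2 : ℝ≥0∞) ^ (5 * κ) * (∑' j : ℤ, (2 : ℝ≥0∞) ^ (κ * (j : ℝ)) * a j ^ 2) *
        (∑' l : ℤ, (2 : ℝ≥0∞) ^ l * s l) := by
  set R : ℝ≥0∞ := ∑' l : ℤ, (2 : ℝ≥0∞) ^ l * s l with hR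
  set Y : ℝ≥0∞ := ∑' j : ℤ, (2 : ℝ≥0∞) ^ (κ * (j : ℝ)) * a j ^ 2 with hY
  set F : ℤ → ℤ → ℤ → ℝ≥0∞ := fun m j l =>
    (2 : ℝ≥0∞) ^ (κ * (j : ℝ)) * s j * (a l * ((2 : ℝ≥0∞) ^ (l + m) * a (l + m))) with hF
  have hstep1 : ∑' j : ℤ, (2 : ℝ≥0∞) ^ (κ * (j : ℝ)) * (s j * paraQ2 a (fun l => (2 : ℝ≥0∞) ^ l * a l) j) =
      ∑ m ∈ Finset.Icc (-2 : ℤ) 2, ∑' j : ℤ, ∑' n : ℕ, F m j (j - 4 + n) := by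
    calc ∑' j : ℤ, (2 : ℝ≥0∞) ^ (κ * (j : ℝ)) * (s j * paraQ2 a (fun l => (2 : ℝ≥0∞) ^ l * a l) j)
        = ∑' j : ℤ, ((2 : ℝ≥0∞) ^ (κ * (j : ℝ)) * s j) * paraQ2 a (fun l => (2 : ℝ≥0∞) ^ l * a l) j :=
          tsum_congr fun j => by ring
      _ = ∑' j : ℤ, ∑' n : ℕ, ∑ m ∈ Finset.Icc (-2 : ℤ) 2, F m j (j - 4 + n) := by
          refine tsum_congr fun j => ?_
          simp only [paraQ2]
          rw [← ENNReal.tsum_mul_left]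
          refine tsum_congr fun n => ?_
          simp only [hF, Finset.mul_sum]
      _ = ∑ m ∈ Finset.Icc (-2 : ℤ) 2, ∑' j : ℤ, ∑' n : ℕ, F m j (j - 4 + n) := by
          rw [← Summable.tsum_finsetSum (fun _ _ => ENNReal.summable)]
          refine tsum_congr fun j => ?_
          exact Summable.tsum_finsetSum (fun _ _ => ENNReal.summable)
  -- the weight moved to the fine level: `2^{κ(l+4−n)} s_{l+4−n} ≤ 2^{(κ−1)(l+4)} · 2^{l+4−n} s_{l+4−n}`
  have hmove : ∀ (l : ℤ) (n : ℕ), (2 : ℝ≥0∞) ^ (κ * (((l + 4 - n : ℤ)) : ℝ)) * s (l + 4 - n) ≤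
      (2 : ℝ≥0∞) ^ ((κ - 1) * ((l : ℝ) + 4)) * ((2 : ℝ≥0∞) ^ (l + 4 - (n : ℤ)) * s (l + 4 - n)) := by
    intro l n
    have hn : (0 : ℝ) ≤ n := Nat.cast_nonneg n
    have epow : (2 : ℝ≥0∞) ^ (κ * (((l + 4 - n : ℤ)) : ℝ)) =
        (2 : ℝ≥0∞) ^ ((κ - 1) * ((l : ℝ) + 4 - n)) * (2 : ℝ≥0∞) ^ (l + 4 - (n : ℤ)) := by
      rw [← ENNReal.rpow_intCast _ (l + 4 - (n : ℤ)), ← two_rpow_add]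
      congr 1; push_cast; ring
    rw [epow, mul_assoc]
    refine mul_le_mul' (ENNReal.rpow_le_rpow_of_exponent_le (by norm_num) ?_) le_rfl
    have hk : 0 ≤ κ - 1 := by linarith
    nlinarith
  have hinner : ∀ l : ℤ, ∑' n : ℕ, (2 : ℝ≥0∞) ^ (κ * (((l + 4 - n : ℤ)) : ℝ)) * s (l + 4 - n) ≤
      (2 : ℝ≥0∞) ^ ((κ - 1) * ((l : ℝ) + 4)) * R := by
    intro l
    calc ∑' n : ℕ, (2 : ℝ≥0∞) ^ (κ * (((l + 4 - n : ℤ)) : ℝ)) * s (l + 4 - n)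
        ≤ ∑' n : ℕ, (2 : ℝ≥0∞) ^ ((κ - 1) * ((l : ℝ) + 4)) * ((2 : ℝ≥0∞) ^ (l + 4 - (n : ℤ)) * s (l + 4 - n)) :=
          ENNReal.tsum_le_tsum (hmove l)
      _ = (2 : ℝ≥0∞) ^ ((κ - 1) * ((l : ℝ) + 4)) * ∑' n : ℕ, (2 : ℝ≥0∞) ^ (l + 4 - (n : ℤ)) * s (l + 4 - n) :=
          ENNReal.tsum_mul_left
      _ ≤ (2 : ℝ≥0∞) ^ ((κ - 1) * ((l : ℝ) + 4)) * R := mul_le_mul' le_rfl (tsum_shift_le_row s (l + 4))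
  have hm_bound : ∀ m ∈ Finset.Icc (-2 : ℤ) 2, ∑' j : ℤ, ∑' n : ℕ, F m j (j - 4 + n) ≤
      (2 : ℝ≥0∞) ^ (5 * κ) * Y * R := by
    intro m hm
    rw [Finset.mem_Icc] at hm
    rw [tsum_tsum_reindex (F m)]
    have hsplit : ∀ l : ℤ, ∑' n : ℕ, F m (l + 4 - n) l =
        (∑' n : ℕ, (2 : ℝ≥0∞) ^ (κ * (((l + 4 - n : ℤ)) : ℝ)) * s (l + 4 - n)) *
          (a l * ((2 : ℝ≥0∞) ^ (l + m) * a (l + m))) := by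
      intro l
      rw [← ENNReal.tsum_mul_right]
    have hcoef : ∀ l : ℤ, (2 : ℝ≥0∞) ^ ((κ - 1) * ((l : ℝ) + 4)) * (a l * ((2 : ℝ≥0∞) ^ (l + m) * a (l + m))) =
        (2 : ℝ≥0∞) ^ (4 * κ - 4 + (m : ℝ)) * ((2 : ℝ≥0∞) ^ (κ * (l : ℝ)) * (a l * a (l + m))) := by
      intro l
      rw [← ENNReal.rpow_intCast _ (l + m)]
      have epow : (2 : ℝ≥0∞) ^ ((κ - 1) * ((l : ℝ) + 4)) * (2 : ℝ≥0∞) ^ (((l + m : ℤ) : ℝ)) =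
          (2 : ℝ≥0∞) ^ (4 * κ - 4 + (m : ℝ)) * (2 : ℝ≥0∞) ^ (κ * (l : ℝ)) := by
        rw [← two_rpow_add, ← two_rpow_add]
        congr 1; push_cast; ring
      calc (2 : ℝ≥0∞) ^ ((κ - 1) * ((l : ℝ) + 4)) * (a l * ((2 : ℝ≥0∞) ^ (((l + m : ℤ) : ℝ)) * a (l + m)))
          = ((2 : ℝ≥0∞) ^ ((κ - 1) * ((l : ℝ) + 4)) * (2 : ℝ≥0∞) ^ (((l + m : ℤ) : ℝ))) * (a l * a (l + m)) := by
            ring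
        _ = _ := by rw [epow]; ring
    have hpow : (2 : ℝ≥0∞) ^ (4 * κ - 4 + (m : ℝ)) * (2 : ℝ≥0∞) ^ (-(κ / 2) * (m : ℝ)) ≤ (2 : ℝ≥0∞) ^ (5 * κ) := by
      rw [← two_rpow_add]
      have hm1 : (-2 : ℝ) ≤ m := by exact_mod_cast hm.1
      have hm2 : (m : ℝ) ≤ 2 := by exact_mod_cast hm.2
      refine ENNReal.rpow_le_rpow_of_exponent_le (by norm_num) ?_
      nlinarith [mul_nonneg (by linarith : (0 : ℝ) ≤ m + 2) (by linarith : (0 : ℝ) ≤ κ)]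
    calc ∑' l : ℤ, ∑' n : ℕ, F m (l + 4 - n) l
        = ∑' l : ℤ, (∑' n : ℕ, (2 : ℝ≥0∞) ^ (κ * (((l + 4 - n : ℤ)) : ℝ)) * s (l + 4 - n)) *
            (a l * ((2 : ℝ≥0∞) ^ (l + m) * a (l + m))) := tsum_congr hsplit
      _ ≤ ∑' l : ℤ, ((2 : ℝ≥0∞) ^ ((κ - 1) * ((l : ℝ) + 4)) * R) * (a l * ((2 : ℝ≥0∞) ^ (l + m) * a (l + m))) :=
          ENNReal.tsum_le_tsum fun l => mul_le_mul' (hinner l) le_rfl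
      _ = ∑' l : ℤ, R * ((2 : ℝ≥0∞) ^ (4 * κ - 4 + (m : ℝ)) * ((2 : ℝ≥0∞) ^ (κ * (l : ℝ)) * (a l * a (l + m)))) := by
          refine tsum_congr fun l => ?_
          rw [← hcoef l]; ring
      _ = R * (2 : ℝ≥0∞) ^ (4 * κ - 4 + (m : ℝ)) * ∑' l : ℤ, (2 : ℝ≥0∞) ^ (κ * (l : ℝ)) * (a l * a (l + m)) := by
          rw [ENNReal.tsum_mul_left, ENNReal.tsum_mul_left]; ring
      _ ≤ R * (2 : ℝ≥0∞) ^ (4 * κ - 4 + (m : ℝ)) * ((2 : ℝ≥0∞) ^ (-(κ / 2) * (m : ℝ)) * Y) :=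
          mul_le_mul' le_rfl (tsum_weight_mul_shift_le a κ m)
      _ = ((2 : ℝ≥0∞) ^ (4 * κ - 4 + (m : ℝ)) * (2 : ℝ≥0∞) ^ (-(κ / 2) * (m : ℝ))) * Y * R := by ring
      _ ≤ (2 : ℝ≥0∞) ^ (5 * κ) * Y * R := by gcongr
  calc _ = ∑ m ∈ Finset.Icc (-2 : ℤ) 2, ∑' j : ℤ, ∑' n : ℕ, F m j (j - 4 + n) := hstep1
    _ ≤ ∑ m ∈ Finset.Icc (-2 : ℤ) 2, (2 : ℝ≥0∞) ^ (5 * κ) * Y * R := Finset.sum_le_sum hm_bound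
    _ = 5 * ((2 : ℝ≥0∞) ^ (5 * κ) * Y * R) := by
        rw [Finset.sum_const]
        simp
    _ = 5 * (2 : ℝ≥0∞) ^ (5 * κ) * Y * R := by ring

/-! ## The summation -/

/-- **THE LIPSCHITZ SUMMATION AT A GENERAL WEIGHT** (`κ ≥ 1`). With `C_κ = 5·2^κ + 5·2^{5κ}` (finite): for all
`a, s ≥ 0` on `ℤ`,
`∑_j 2^{κj} (a_j ∑_{|m|≤2} a_{j+m} T_{j+m} + s_j Q_j) ≤ C_κ · (∑_j 2^{κj} a_j²) · ∑_l 2^l s_l`,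
`T = paraT (2^· s)`, `Q = paraQ2 a (2^· a)` — the `2^{κj}`-weighted nonlinear side of the block balances is controlled by
the row itself times the Lipschitz row, WHATEVER `κ ≥ 1` (no Bernstein relation, no partner row; compare
`riccati_summation_gen`, `κ < 5`). [cite: RobinsonSadowskiSilva2012, §III (3.6)] [cite: BahouriCheminDanchin2011, Lemma 2.100] -/
theorem lipschitz_summation {κ : ℝ} (hκ1 : 1 ≤ κ) :
    ∃ C : ℝ≥0∞, C ≠ ∞ ∧ ∀ (a s : ℤ → ℝ≥0∞),
      ∑' j : ℤ, (2 : ℝ≥0∞) ^ (κ * (j : ℝ)) *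
          (a j * ∑ m ∈ Finset.Icc (-2 : ℤ) 2, a (j + m) * paraT (fun l' => (2 : ℝ≥0∞) ^ l' * s l') (j + m) +
            s j * paraQ2 a (fun l => (2 : ℝ≥0∞) ^ l * a l) j) ≤
        C * (∑' j : ℤ, (2 : ℝ≥0∞) ^ (κ * (j : ℝ)) * a j ^ 2) * (∑' l : ℤ, (2 : ℝ≥0∞) ^ l * s l) := by
  have h2top : ∀ y : ℝ, (2 : ℝ≥0∞) ^ y ≠ ∞ := fun y => RiccatiSlice.two_rpow_ne_top y
  refine ⟨5 * (2 : ℝ≥0∞) ^ κ + 5 * (2 : ℝ≥0∞) ^ (5 * κ),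
    ENNReal.add_ne_top.2 ⟨ENNReal.mul_ne_top (by norm_num) (h2top _), ENNReal.mul_ne_top (by norm_num) (h2top _)⟩,
    fun a s => ?_⟩
  set R : ℝ≥0∞ := ∑' l : ℤ, (2 : ℝ≥0∞) ^ l * s l with hR
  set Y : ℝ≥0∞ := ∑' j : ℤ, (2 : ℝ≥0∞) ^ (κ * (j : ℝ)) * a j ^ 2 with hY
  set T := fun l' : ℤ => (2 : ℝ≥0∞) ^ l' * s l' with hT
  have hsplit : ∑' j : ℤ, (2 : ℝ≥0∞) ^ (κ * (j : ℝ)) *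
      (a j * ∑ m ∈ Finset.Icc (-2 : ℤ) 2, a (j + m) * paraT T (j + m) + s j * paraQ2 a (fun l => (2 : ℝ≥0∞) ^ l * a l) j) =
      (∑ m ∈ Finset.Icc (-2 : ℤ) 2, ∑' j : ℤ, (2 : ℝ≥0∞) ^ (κ * (j : ℝ)) * (a j * (a (j + m) * paraT T (j + m)))) +
        ∑' j : ℤ, (2 : ℝ≥0∞) ^ (κ * (j : ℝ)) * (s j * paraQ2 a (fun l => (2 : ℝ≥0∞) ^ l * a l) j) := by
    rw [← Summable.tsum_finsetSum (fun _ _ => ENNReal.summable), ← ENNReal.tsum_add]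
    refine tsum_congr fun j => ?_
    rw [mul_add, Finset.mul_sum, Finset.mul_sum]
  rw [hsplit]
  have hL : ∑ m ∈ Finset.Icc (-2 : ℤ) 2, ∑' j : ℤ, (2 : ℝ≥0∞) ^ (κ * (j : ℝ)) * (a j * (a (j + m) * paraT T (j + m))) ≤
      ∑ m ∈ Finset.Icc (-2 : ℤ) 2, (2 : ℝ≥0∞) ^ κ * Y * R := by
    refine Finset.sum_le_sum fun m hm => ?_
    rw [Finset.mem_Icc] at hm
    exact lowHigh_lipschitz_le a s (by linarith) m hm.1
  have hH := highHigh_lipschitz_le a s hκ1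
  calc _ ≤ (∑ m ∈ Finset.Icc (-2 : ℤ) 2, (2 : ℝ≥0∞) ^ κ * Y * R) + 5 * (2 : ℝ≥0∞) ^ (5 * κ) * Y * R :=
        add_le_add hL hH
    _ = (5 * (2 : ℝ≥0∞) ^ κ + 5 * (2 : ℝ≥0∞) ^ (5 * κ)) * Y * R := by
        rw [Finset.sum_const]
        simp
        ring

/-! ## The field-level corollary -/

/-- **THE TRANSFER AT ANY WEIGHT IS SLAVED TO THE LIPSCHITZ ROW.** For every `κ ≥ 1` there is a finite `A = A_κ` such
that for every smooth, divergence-free `L²` field `w` on `ℝ³`: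
`∑_j 2^{κj} ‖∫ ⟪Δ̇_j w, Δ̇_j((w·∇)w)⟫‖ ≤ A · (∑_j 2^{κj} ‖Δ̇_j w‖₂²) · ∑_l 2^l ‖Δ̇_l w‖_∞`
(`RiccatiSlice.exists_enorm_transfer_le_local`, the pointwise low-mode ceiling, summed with `lipschitz_summation`) — the
dyadic form of `|⟨Λ^s((w·∇)w), Λ^s w⟩| ≲ ‖w‖²_{Ḣ^s} ∫|ξ||ŵ|` (Robinson–Sadowski–Silva (3.6)) / of the Besov commutator
estimate, for EVERY order `s = κ/2 ≥ 1/2`. [cite: RobinsonSadowskiSilva2012, §III (3.6)]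
[cite: BahouriCheminDanchin2011, Lemma 2.100] -/
theorem transfer_row_le_lipschitz {κ : ℝ} (hκ1 : 1 ≤ κ) :
    ∃ A : ℝ≥0∞, A ≠ ∞ ∧ ∀ (w : EuclideanSpace ℝ (Fin 3) → EuclideanSpace ℝ (Fin 3)),
      IsSmoothL2Field w → VectorCalculus.IsDivFree w →
        ∑' j : ℤ, (2 : ℝ≥0∞) ^ (κ * (j : ℝ)) * ‖∫ x, ⟪blockFn j w x, blockFn j (convect w w) x⟫‖ₑ ≤
          A * (∑' j : ℤ, (2 : ℝ≥0∞) ^ (κ * (j : ℝ)) * blockL2 w j ^ 2) *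
            (∑' l : ℤ, (2 : ℝ≥0∞) ^ l * blockSup w l) := by
  obtain ⟨A, hAtop, hA⟩ := RiccatiSlice.exists_enorm_transfer_le_local
  obtain ⟨C, hCtop, hC⟩ := lipschitz_summation hκ1
  refine ⟨A * C, ENNReal.mul_ne_top hAtop hCtop, fun w hw hdiv => ?_⟩
  calc ∑' j : ℤ, (2 : ℝ≥0∞) ^ (κ * (j : ℝ)) * ‖∫ x, ⟪blockFn j w x, blockFn j (convect w w) x⟫‖ₑ
      ≤ ∑' j : ℤ, (2 : ℝ≥0∞) ^ (κ * (j : ℝ)) *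
          (A * (blockL2 w j * ∑ m ∈ Finset.Icc (-2 : ℤ) 2, blockL2 w (j + m) *
                paraT (fun l => (2 : ℝ≥0∞) ^ l * blockSup w l) (j + m) +
              blockSup w j * paraQ2 (blockL2 w) (fun l => (2 : ℝ≥0∞) ^ l * blockL2 w l) j)) :=
        ENNReal.tsum_le_tsum fun j => mul_le_mul' le_rfl (hA w hw hdiv j)
    _ = A * ∑' j : ℤ, (2 : ℝ≥0∞) ^ (κ * (j : ℝ)) *
          (blockL2 w j * ∑ m ∈ Finset.Icc (-2 : ℤ) 2, blockL2 w (j + m) *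
                paraT (fun l => (2 : ℝ≥0∞) ^ l * blockSup w l) (j + m) +
              blockSup w j * paraQ2 (blockL2 w) (fun l => (2 : ℝ≥0∞) ^ l * blockL2 w l) j) := by
        rw [← ENNReal.tsum_mul_left]
        exact tsum_congr fun j => by ring
    _ ≤ A * (C * (∑' j : ℤ, (2 : ℝ≥0∞) ^ (κ * (j : ℝ)) * blockL2 w j ^ 2) *
          (∑' l : ℤ, (2 : ℝ≥0∞) ^ l * blockSup w l)) := mul_le_mul' le_rfl (hC (blockL2 w) (blockSup w))
    _ = _ := by ring

end Summit.NavierStokesRegularity.FluidComputer.LipschitzSummation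

end
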